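import Mathlib

/-!
# Clifford theory for an index-two subgroup: extensions differ by a sign character
(solo-Langlands-blind, s8)

Kernel anchor for §5.2.2 / §5.12(b) of the dihedral door (HOME/paper/dihedral-descent.md): if two
representations `ρ₁, ρ₂ : G → GL_n(R)` agree on a normal subgroup `H` on which `ρ₁` is absolutely
irreducible in the operational sense (every invertible matrix commuting with `ρ₁(H)` is a scalar),
then `ρ₁ = c ⊗ ρ₂` for a character `c : G → Rˣ` trivial on `H`; if `[G : H] = 2` the character is
`±1`-valued and constant off `H`, i.e. `c ∈ {1, sgn_H}`: an irreducible representation of an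
index-two subgroup has at most two extensions, differing by the quadratic character of `G/H`.
Used with `G = G_K ⊃ H = G_{K̃}` (the pair `{ρ, ρ ⊗ ε_{K̃/K}}`) and `G = G_{L₂} ⊃ H = G_{LL₂}`.

Pure group theory / linear algebra over a commutative ring.
-/

namespace Summit.Langlands.Langlands.Theorems.SoloBlind

open Matrix

variable {G : Type*} [Group G] {n : Type*} [Fintype n] [DecidableEq n] {R : Type*} [CommRing R]

/-- Cancellation of scalars against an invertible matrix (needs a nonempty index type). -/
theorem smul_generalLinearGroup_cancel [Nonempty n] (X : Matrix.GeneralLinearGroup n R) (a b : R)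
    (h : a • (X : Matrix n n R) = b • (X : Matrix n n R)) : a = b := by
  have h' := congrArg (· * ((X⁻¹ : Matrix.GeneralLinearGroup n R) : Matrix n n R)) h
  simp only [smul_mul_assoc, Units.mul_inv] at h'
  obtain ⟨i⟩ := ‹Nonempty n›
  have := congrFun (congrFun h' i) i
  simpa using this

/-- The transport element `ρ₂(g)⁻¹ ρ₁(g)` centralises `ρ₁(H)` when `ρ₁ = ρ₂` on the normal
subgroup `H`. -/
theorem transport_comm_of_restrict_eq (H : Subgroup G) [hN : H.Normal]
    (ρ₁ ρ₂ : G →* Matrix.GeneralLinearGroup n R) (hagree : ∀ h ∈ H, ρ₁ h = ρ₂ h) (g : G) :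
    ∀ h ∈ H, ((ρ₂ g)⁻¹ * ρ₁ g) * ρ₁ h = ρ₁ h * ((ρ₂ g)⁻¹ * ρ₁ g) := by
  intro h hh
  have key : ρ₁ (g * h) = ρ₂ (g * h * g⁻¹) * ρ₁ g := by
    calc ρ₁ (g * h) = ρ₁ ((g * h * g⁻¹) * g) := by congr 1; group
      _ = ρ₁ (g * h * g⁻¹) * ρ₁ g := map_mul _ _ _
      _ = ρ₂ (g * h * g⁻¹) * ρ₁ g := by rw [hagree _ (hN.conj_mem h hh g)]
  calc (ρ₂ g)⁻¹ * ρ₁ g * ρ₁ h = (ρ₂ g)⁻¹ * ρ₁ (g * h) := by rw [mul_assoc, ← map_mul]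
    _ = ((ρ₂ g)⁻¹ * ρ₂ (g * h * g⁻¹)) * ρ₁ g := by rw [key, ← mul_assoc]
    _ = ρ₂ (g⁻¹ * (g * h * g⁻¹)) * ρ₁ g := by rw [← map_inv, ← map_mul]
    _ = ρ₂ (h * g⁻¹) * ρ₁ g := by congr 2; group
    _ = ρ₁ h * ((ρ₂ g)⁻¹ * ρ₁ g) := by rw [map_mul, map_inv, hagree h hh, mul_assoc]

/-- **Clifford twist.** Two representations agreeing on a normal subgroup `H`, on which the first is
absolutely irreducible (operational Schur hypothesis `hSchur`: invertible matrices commuting with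
`ρ₁(H)` are scalar), differ by a character of `G` trivial on `H`. -/
theorem exists_character_twist_of_restrict_eq [Nonempty n] (H : Subgroup G) [H.Normal]
    (ρ₁ ρ₂ : G →* Matrix.GeneralLinearGroup n R) (hagree : ∀ h ∈ H, ρ₁ h = ρ₂ h)
    (hSchur : ∀ M : Matrix.GeneralLinearGroup n R, (∀ h ∈ H, M * ρ₁ h = ρ₁ h * M) →
      ∃ c : Rˣ, (M : Matrix n n R) = (c : R) • (1 : Matrix n n R)) :
    ∃ c : G →* Rˣ, (∀ h ∈ H, c h = 1) ∧
      ∀ g, (ρ₁ g : Matrix n n R) = (c g : R) • (ρ₂ g : Matrix n n R) := by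
  -- pointwise scalars
  have hpt : ∀ g, ∃ c : Rˣ, (ρ₁ g : Matrix n n R) = (c : R) • (ρ₂ g : Matrix n n R) := by
    intro g
    obtain ⟨c, hc⟩ := hSchur ((ρ₂ g)⁻¹ * ρ₁ g) (transport_comm_of_restrict_eq H ρ₁ ρ₂ hagree g)
    refine ⟨c, ?_⟩
    have hmul : ρ₁ g = ρ₂ g * ((ρ₂ g)⁻¹ * ρ₁ g) := (mul_inv_cancel_left _ _).symm
    calc (ρ₁ g : Matrix n n R) = (ρ₂ g : Matrix n n R) * (((ρ₂ g)⁻¹ * ρ₁ g : _) : Matrix n n R) := by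
          rw [hmul, Units.val_mul]; rw [← hmul]
      _ = (c : R) • (ρ₂ g : Matrix n n R) := by rw [hc, Matrix.mul_smul, Matrix.mul_one]
  choose c hc using hpt
  -- multiplicativity by cancellation
  have hmulc : ∀ a b, c (a * b) = c a * c b := by
    intro a b
    apply Units.ext
    apply smul_generalLinearGroup_cancel (ρ₂ (a * b))
    have h1 : (ρ₁ (a * b) : Matrix n n R) = ((c a * c b : Rˣ) : R) • (ρ₂ (a * b) : Matrix n n R) := by
      rw [map_mul, map_mul, Units.val_mul, Units.val_mul, hc a, hc b, Units.val_mul,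
        smul_mul_assoc, mul_smul_comm, smul_smul]
    rw [← hc (a * b), h1]
  refine ⟨MonoidHom.mk' c hmulc, ?_, ?_⟩
  · intro h hh
    apply Units.ext
    apply smul_generalLinearGroup_cancel (ρ₂ h)
    show (c h : R) • (ρ₂ h : Matrix n n R) = ((1 : Rˣ) : R) • (ρ₂ h : Matrix n n R)
    rw [← hc h, hagree h hh, Units.val_one, one_smul]
  · intro g
    exact hc g

/-- **Index two: the twisting character is `1` or `sgn_H`.** A character `c : G → Rˣ` trivial on a
subgroup `H` of index two is `±1`-valued (in a ring without zero divisors) and constant on the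
non-trivial coset; hence an absolutely irreducible representation of `H` has at most the two
extensions `ρ, ρ ⊗ sgn_H` to `G`. -/
theorem character_trivial_on_index_two [NoZeroDivisors R] (H : Subgroup G) (hidx : H.index = 2)
    (c : G →* Rˣ) (hc : ∀ h ∈ H, c h = 1) :
    (∀ g, (c g : R) = 1 ∨ (c g : R) = -1) ∧ (∀ g g', g ∉ H → g' ∉ H → c g = c g') := by
  refine ⟨fun g => ?_, fun g g' hg hg' => ?_⟩
  · have hsq : c (g * g) = 1 := hc _ (Subgroup.mul_self_mem_of_index_two hidx g)
    rw [map_mul] at hsq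
    have : (c g : R) * (c g : R) = 1 := by
      have := congrArg Units.val hsq
      simpa using this
    exact mul_self_eq_one_iff.mp this
  · have hmem : g⁻¹ * g' ∈ H :=
      (Subgroup.mul_mem_iff_of_index_two hidx).mpr (iff_of_false (by simpa using hg) hg')
    have h1 : c (g⁻¹ * g') = 1 := hc _ hmem
    rw [map_mul, map_inv, inv_mul_eq_one] at h1
    exact h1

/-- **Clifford theory, index two (assembled).** If `ρ₁, ρ₂ : G → GL_n(R)` agree on an index-two
subgroup `H` on which `ρ₁` is absolutely irreducible (operational Schur hypothesis), then
`ρ₁ = c ⊗ ρ₂` with `c : G → {±1}` trivial on `H` and constant off `H` — i.e. `ρ₁ = ρ₂` or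
`ρ₁ = ρ₂ ⊗ sgn_H`. -/
theorem clifford_index_two [Nonempty n] [NoZeroDivisors R] (H : Subgroup G) (hidx : H.index = 2)
    (ρ₁ ρ₂ : G →* Matrix.GeneralLinearGroup n R) (hagree : ∀ h ∈ H, ρ₁ h = ρ₂ h)
    (hSchur : ∀ M : Matrix.GeneralLinearGroup n R, (∀ h ∈ H, M * ρ₁ h = ρ₁ h * M) →
      ∃ c : Rˣ, (M : Matrix n n R) = (c : R) • (1 : Matrix n n R)) :
    ∃ c : G →* Rˣ, (∀ h ∈ H, c h = 1) ∧ (∀ g, (c g : R) = 1 ∨ (c g : R) = -1) ∧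
      (∀ g g', g ∉ H → g' ∉ H → c g = c g') ∧
      ∀ g, (ρ₁ g : Matrix n n R) = (c g : R) • (ρ₂ g : Matrix n n R) := by
  haveI : H.Normal := Subgroup.normal_of_index_eq_two hidx
  obtain ⟨c, hcH, hcρ⟩ := exists_character_twist_of_restrict_eq H ρ₁ ρ₂ hagree hSchur
  obtain ⟨hpm, hconst⟩ := character_trivial_on_index_two H hidx c hcH
  exact ⟨c, hcH, hpm, hconst, hcρ⟩

/-- The dichotomy spelled out: either `ρ₁ = ρ₂` on all of `G`, or `ρ₁ = ρ₂` on `H` and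
`ρ₁ = -ρ₂` (as matrices) off `H`. -/
theorem clifford_index_two_dichotomy [Nonempty n] [NoZeroDivisors R] (H : Subgroup G)
    (hidx : H.index = 2) (ρ₁ ρ₂ : G →* Matrix.GeneralLinearGroup n R)
    (hagree : ∀ h ∈ H, ρ₁ h = ρ₂ h)
    (hSchur : ∀ M : Matrix.GeneralLinearGroup n R, (∀ h ∈ H, M * ρ₁ h = ρ₁ h * M) →
      ∃ c : Rˣ, (M : Matrix n n R) = (c : R) • (1 : Matrix n n R)) :
    (∀ g, (ρ₁ g : Matrix n n R) = (ρ₂ g : Matrix n n R)) ∨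
      (∀ g, g ∉ H → (ρ₁ g : Matrix n n R) = -(ρ₂ g : Matrix n n R)) := by
  obtain ⟨c, hcH, hpm, hconst, hcρ⟩ := clifford_index_two H hidx ρ₁ ρ₂ hagree hSchur
  by_cases hall : ∀ g, (c g : R) = 1
  · left
    intro g
    rw [hcρ g, hall g, one_smul]
  · right
    obtain ⟨g₀, hg₀⟩ := not_forall.mp hall
    have hg₀H : g₀ ∉ H := fun hmem => hg₀ (by rw [hcH g₀ hmem, Units.val_one])
    have hneg : (c g₀ : R) = -1 := (hpm g₀).resolve_left hg₀
    intro g hg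
    rw [hcρ g, hconst g g₀ hg hg₀H, hneg, neg_one_smul]

end Summit.Langlands.Langlands.Theorems.SoloBlind
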